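import Summits.QuantumFields.YangMills.Theorems.BalabanUVNodesN08HaarCompatibilityGuard

/-!
# BalabanUVNodes ∕ N08 — THE GUARD SPLIT OF THE ONE-STEP CLOSURE: for an ARBITRARY input measure `μ` on level-`j` fields,
# `μ∘Ū⁻¹ ≤ μ∘axial⁻¹ + (μ↾guard)∘Ū⁻¹`, `(c·dU)∘axial⁻¹ = c·dV`; hence `(dU + ν)∘Ū⁻¹ ≤ dV + [(dU↾guard)∘Ū⁻¹ + ν∘Ū⁻¹]` — the level-by-level
# measure family behind the history masses, whose ONLY density-raising summand is the guarded one

WIDTH SEAT `pub-ymgap-dag-n08-w3` g4, `W-SEAT-START-LIST.md` v10 §0 (iii); item-3 lineage part 15 (part 6 p594625 `…Guard` in the currency of MEASURES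
and of the lane's transports `AveragingRT.pushDensity`), 2026-08-28.  DAG node N08 = [Balaban1985UV3] Thm 1 p. 257 (compact) + Thm 2 p. 272; key item
K1⁷ `StabilityBAtRecordR13SepCoPH` (stmt-QuantumFields-20542), `--supports … --as helper`.  COUNT-NEUTRAL.

THE POINT.  n08-w1 g3's (R4⁗) letter (p605761 + `N08-E6PRIME-LOAD-POINT.md`) prices E6′'s entire load in N08 as an extensive bound on the lane's
history masses `MassesAC.massRecAC`, i.e. on ITERATED transports `Ū_*`; its CLAIM-18 reduces such bounds to ANY family of measures `ν_k` closed under one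
step, `(dU_k + ν_k)∘Ū_k⁻¹ ≤ dU_{k+1} + ν_{k+1}` — and records that NO such family is exhibited for print's averaging.  Part 6 (p594625) proved, for `dU`
itself, that the typed (0.4) averaging IS the axial averaging off its small-field GUARD `G = {U | ∃ c, Small ℰ U c}` and that `axial_*(dU) = dV` exactly.
This file lifts that split to an ARBITRARY input measure and so EXHIBITS the canonical closed family for every small-loop average `ℰ` (in particular
print's `expMeanLogSU` at the [B10] slot `avOfPrint N S j`), every group, in the standing range `j + 1 ≤ m + K`:

* §1 `map_avgFun_eq_add` — `μ∘Ū⁻¹ = (μ↾G)∘Ū⁻¹ + (μ↾Gᶜ)∘axial⁻¹`; ★ `map_avgFun_le` — **`μ∘Ū⁻¹ ≤ μ∘axial⁻¹ + (μ↾G)∘Ū⁻¹`** (and the mirror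
  `μ∘axial⁻¹ ≤ μ∘Ū⁻¹ + (μ↾G)∘axial⁻¹`); `map_axialAvg_le_smul` — `μ ≤ c·dU ⇒ μ∘axial⁻¹ ≤ c·dV`; `map_withDensity_axialAvg_le` — a density `≤ c` is
  transported by the axial averaging to a measure `≤ c·dV` (the axial transport is sub-Markov in sup norm).
* §2 ★★ `map_add_le_closure` — **THE CLOSURE STEP `(dU + ν)∘Ū⁻¹ ≤ dV + [(dU↾G)∘Ū⁻¹ + ν∘Ū⁻¹]`** for every measure `ν`, and `map_le_closure_of_le` for
  every `μ ≤ dU + ν`; `closure_mass` — the new summand has total mass `dU(G) ≤ #PBond(j+1)·Haar{dist1 < δ}` (part 6 `measure_guard_le`; part 7B p596721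
  sharpens the exponent to `L^{d−1} − 1`).  So `ν_{j+1} := (dU_j↾G_j)∘Ū_j⁻¹ + ν_j∘Ū_j⁻¹`, `ν_0 := 0`, is a CLAIM-18 family for print's averaging; unrolled,
  `ν_k = Σ_{j<k} (Ū_{k−1}∘⋯∘Ū_{j+1})_*[(dU_j↾G_j)∘Ū_j⁻¹]`, total mass `Σ_{j<k} dU_j(G_j)`.
* §3 ★ `pushDensity_le` — THE SAME IN THE LANE'S TRANSPORT CURRENCY: for a density `0 ≤ f ≤ C`, `Ū_*(f·dU) ≤ C·dV + Ū_*((1_G·f)·dU)`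
  (`AveragingRT.pushDensity`; the `rnDeriv` ∕ `rnTransport` a.e. form `T f ≤ C + T(1_G f)` follows by monotonicity of `Measure.rnDeriv` under
  `AvgAC` — n08-w1's CLAIM-18 (B), not repeated here).
* §4 at the slot `avOfPrint N S j` on `SU(N)`, every `N`: `map_avOfPrint_le`, `map_add_le_closure_avOfPrint`, `closure_mass_avOfPrint`
  (`dU(G) ≤ #PBond(j+1)·Haar_{SU(N)}{‖W − 1‖ < min(1∕3, π∕N)}`), `pushDensity_avOfPrint_le`.

WHERE THE DENSITY CAN GROW (located; analysis in `HOME/pub-ymgap-dag-n08-w3/N08-EML-JACOBIAN.md`, not a tree claim).  In the closure step only the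
guarded summand `(μ↾G)∘Ū⁻¹` can have a density above its input's sup: its one-bond factor is bounded through the Jacobian of the guarded branch
(part 14 p607823 `…GuardJacobian`: σ_min ≥ 0.92·(1 − Σcᵢ), `1 − Σcᵢ = L^{1−d}` at the slot) once a quantitative local-diffeomorphism engine exists;
the k-uniform extensive bound `hmass` needs in addition the NO-STACKING structure (conditionally on intra-block bonds the guards of distinct coarse
bonds are independent; level-j enhancement survives level-(j+1) axial fibre-averaging only at the next level's private coordinates) — NOT claimed here.

HONEST FRAMING.  [folklore] measure theory over part 6 (nothing of Bałaban's asserted); no density bound, no `hmass`, E6′ NOT decided; count-neutral;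
N08 NOT discharged; counts unmoved (typed 28∕28 · discharged 5∕27); one finite 𝕋⁴ programme at fixed ε — R4 closes the CONDITIONAL rung
`BalabanLadder.UV` only; the Yang–Mills mass gap (Clay) is NOT proved by any of this; nothing continuum ∕ OS.  0 `sorry`, 0 `def`, standard axioms.
-/

noncomputable section

open MeasureTheory
open scoped ENNReal

namespace Summit.QuantumFields.YangMills.BalabanUVNodes.N08HaarCompatibilityGuardTransport

open Literature.MathematicalPhysics.QuantumFieldTheory.Balaban1983to89
open Literature.MathematicalPhysics.QuantumFieldTheory.Balaban1983to89.AveragingRT (axialAvg map_axialAvg measurable_axialAvg pushDensity)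
open Literature.MathematicalPhysics.QuantumFieldTheory.Balaban1983to89.BlockAveraging (Small avgFun measurable_avgFun)
open Summit.QuantumFields.YangMills.BalabanUVNodes.N08HaarCompatibilityGuard
  (avgFun_eq_axialAvg_of_not_mem_guard measurableSet_guard measure_guard_le avOfPrint_avg_of_le)

/-! ## §1 The split of the image of an ARBITRARY measure along the guard -/

section Generic

variable {P : Params} {j : ℕ} {G : Type*} [GaugeGroup G] (ℰ : LoopAverage G) [MeasurableSpace G] [RegularGaugeGroup G]

/-- **`μ∘Ū⁻¹ = (μ↾G)∘Ū⁻¹ + (μ↾Gᶜ)∘axial⁻¹`** for EVERY measure `μ` on level-`j` fields: off the guard `G = {U | ∃ c, Small ℰ U c}` the typed (0.4)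
averaging is the axial one (part 6 `avgFun_eq_axialAvg_of_not_mem_guard`). [cite: Balaban1987RG1, (0.4) p.253 (bookkeeping)] -/
theorem map_avgFun_eq_add (hE : ∀ n, Measurable fun W : Fin (n + 1) → G => ℰ.E W) (μ : Measure (GaugeField P j G)) :
    μ.map (avgFun ℰ) =
      (μ.restrict {U : GaugeField P j G | ∃ c : PBond P (j + 1), Small ℰ U c}).map (avgFun ℰ) +
        (μ.restrict {U : GaugeField P j G | ∃ c : PBond P (j + 1), Small ℰ U c}ᶜ).map axialAvg := by
  have hsplit : μ.map (avgFun ℰ) =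
      (μ.restrict {U : GaugeField P j G | ∃ c : PBond P (j + 1), Small ℰ U c}).map (avgFun ℰ) +
        (μ.restrict {U : GaugeField P j G | ∃ c : PBond P (j + 1), Small ℰ U c}ᶜ).map (avgFun ℰ) := by
    rw [← Measure.map_add _ _ (measurable_avgFun ℰ hE), Measure.restrict_add_restrict_compl (measurableSet_guard ℰ)]
  rw [hsplit]
  congr 1
  refine Measure.map_congr ?_
  filter_upwards [ae_restrict_mem (measurableSet_guard ℰ).compl] with U hU
  exact avgFun_eq_axialAvg_of_not_mem_guard ℰ hU

/-- The mirror split for the axial averaging: `μ∘axial⁻¹ = (μ↾G)∘axial⁻¹ + (μ↾Gᶜ)∘Ū⁻¹`. [folklore] -/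
theorem map_axialAvg_eq_add (μ : Measure (GaugeField P j G)) :
    μ.map axialAvg =
      (μ.restrict {U : GaugeField P j G | ∃ c : PBond P (j + 1), Small ℰ U c}).map axialAvg +
        (μ.restrict {U : GaugeField P j G | ∃ c : PBond P (j + 1), Small ℰ U c}ᶜ).map (avgFun ℰ) := by
  have hsplit : μ.map (axialAvg : GaugeField P j G → GaugeField P (j + 1) G) =
      (μ.restrict {U : GaugeField P j G | ∃ c : PBond P (j + 1), Small ℰ U c}).map axialAvg +
        (μ.restrict {U : GaugeField P j G | ∃ c : PBond P (j + 1), Small ℰ U c}ᶜ).map axialAvg := by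
    rw [← Measure.map_add _ _ measurable_axialAvg, Measure.restrict_add_restrict_compl (measurableSet_guard ℰ)]
  rw [hsplit]
  congr 1
  refine Measure.map_congr ?_
  filter_upwards [ae_restrict_mem (measurableSet_guard ℰ).compl] with U hU
  exact (avgFun_eq_axialAvg_of_not_mem_guard ℰ hU).symm

/-- ★ **THE GUARD SPLIT FOR AN ARBITRARY INPUT MEASURE: `μ∘Ū⁻¹ ≤ μ∘axial⁻¹ + (μ↾G)∘Ū⁻¹`** — the image of ANY measure under the typed (0.4) averaging
is dominated by its image under the axial averaging plus the image of its restriction to the guard. [cite: Balaban1987RG1, (0.4) p.253 (bookkeeping)] -/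
theorem map_avgFun_le (hE : ∀ n, Measurable fun W : Fin (n + 1) → G => ℰ.E W) (μ : Measure (GaugeField P j G)) :
    μ.map (avgFun ℰ) ≤ μ.map axialAvg + (μ.restrict {U : GaugeField P j G | ∃ c : PBond P (j + 1), Small ℰ U c}).map (avgFun ℰ) := by
  have hc : (μ.restrict {U : GaugeField P j G | ∃ c : PBond P (j + 1), Small ℰ U c}ᶜ).map axialAvg ≤ μ.map axialAvg :=
    Measure.map_mono Measure.restrict_le_self measurable_axialAvg
  rw [map_avgFun_eq_add ℰ hE μ]
  refine Measure.le_iff.2 fun s hs => ?_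
  simp only [Measure.add_apply]
  calc _ ≤ (μ.restrict {U : GaugeField P j G | ∃ c : PBond P (j + 1), Small ℰ U c}).map (avgFun ℰ) s + μ.map axialAvg s :=
        add_le_add le_rfl (hc s)
    _ = _ := add_comm _ _

/-- The mirror: `μ∘axial⁻¹ ≤ μ∘Ū⁻¹ + (μ↾G)∘axial⁻¹`. [folklore] -/
theorem map_axialAvg_le (hE : ∀ n, Measurable fun W : Fin (n + 1) → G => ℰ.E W) (μ : Measure (GaugeField P j G)) :
    μ.map axialAvg ≤ μ.map (avgFun ℰ) + (μ.restrict {U : GaugeField P j G | ∃ c : PBond P (j + 1), Small ℰ U c}).map axialAvg := by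
  have hc : (μ.restrict {U : GaugeField P j G | ∃ c : PBond P (j + 1), Small ℰ U c}ᶜ).map (avgFun ℰ) ≤ μ.map (avgFun ℰ) :=
    Measure.map_mono Measure.restrict_le_self (measurable_avgFun ℰ hE)
  rw [map_axialAvg_eq_add ℰ μ]
  refine Measure.le_iff.2 fun s hs => ?_
  simp only [Measure.add_apply]
  calc _ ≤ (μ.restrict {U : GaugeField P j G | ∃ c : PBond P (j + 1), Small ℰ U c}).map axialAvg s + μ.map (avgFun ℰ) s :=
        add_le_add le_rfl (hc s)
    _ = _ := add_comm _ _

variable [HaarData G]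

/-- **`μ ≤ c·dU ⇒ μ∘axial⁻¹ ≤ c·dV`** (standing range): the axial averaging is EXACTLY Haar compatible (`AveragingRT.map_axialAvg`), so it transports a
dominated measure to a dominated measure with the same constant. [cite: Balaban1987RG1, (0.13) p.254 (the axial case; bookkeeping)] -/
theorem map_axialAvg_le_smul (hj : j + 1 ≤ P.m + P.K) {μ : Measure (GaugeField P j G)} {c : ℝ≥0∞} (hμ : μ ≤ c • fieldMeasure P j G) :
    μ.map axialAvg ≤ c • fieldMeasure P (j + 1) G := by
  calc μ.map axialAvg ≤ (c • fieldMeasure P j G).map axialAvg := Measure.map_mono hμ measurable_axialAvg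
    _ = c • (fieldMeasure P j G).map axialAvg := Measure.map_smul _ _ _
    _ = c • fieldMeasure P (j + 1) G := by rw [map_axialAvg (G := G) hj]

/-- **A density bounded by `c` is transported by the axial averaging to a measure `≤ c·dV`** (the axial transport is sub-Markov in the sup norm).
[cite: Balaban1987RG1, (0.13) p.254 (the axial case; bookkeeping)] -/
theorem map_withDensity_axialAvg_le (hj : j + 1 ≤ P.m + P.K) {ρ : GaugeField P j G → ℝ≥0∞} {c : ℝ≥0∞} (hρ : ∀ U, ρ U ≤ c) :
    ((fieldMeasure P j G).withDensity ρ).map axialAvg ≤ c • fieldMeasure P (j + 1) G := by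
  refine map_axialAvg_le_smul hj ?_
  calc (fieldMeasure P j G).withDensity ρ ≤ (fieldMeasure P j G).withDensity fun _ => c :=
        withDensity_mono (Filter.Eventually.of_forall hρ)
    _ = c • fieldMeasure P j G := withDensity_const c

/-! ## §2 The closure step and its mass -/

/-- ★★ **THE CLOSURE STEP `(dU + ν)∘Ū⁻¹ ≤ dV + [(dU↾G)∘Ū⁻¹ + ν∘Ū⁻¹]`** for EVERY measure `ν` on level-`j` fields (standing range, any measurable small-loop
average): the measure family `ν_{j+1} := (dU_j↾G_j)∘Ū_j⁻¹ + ν_j∘Ū_j⁻¹` is closed under one step in the sense of n08-w1's CLAIM-18, for the typed (0.4)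
averaging. [cite: Balaban1987RG1, (0.4) p.253 (bookkeeping)] -/
theorem map_add_le_closure (hj : j + 1 ≤ P.m + P.K) (hE : ∀ n, Measurable fun W : Fin (n + 1) → G => ℰ.E W) (ν : Measure (GaugeField P j G)) :
    (fieldMeasure P j G + ν).map (avgFun ℰ) ≤
      fieldMeasure P (j + 1) G +
        (((fieldMeasure P j G).restrict {U : GaugeField P j G | ∃ c : PBond P (j + 1), Small ℰ U c}).map (avgFun ℰ) + ν.map (avgFun ℰ)) := by
  rw [Measure.map_add _ _ (measurable_avgFun ℰ hE), ← add_assoc, ← map_axialAvg (G := G) hj]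
  refine Measure.le_iff.2 fun s hs => ?_
  have h := map_avgFun_le ℰ hE (fieldMeasure P j G) s
  simp only [Measure.add_apply] at h ⊢
  exact add_le_add h le_rfl

/-- The closure step for any DOMINATED input: `μ ≤ dU + ν ⇒ μ∘Ū⁻¹ ≤ dV + [(dU↾G)∘Ū⁻¹ + ν∘Ū⁻¹]`. [cite: Balaban1987RG1, (0.4) p.253 (bookkeeping)] -/
theorem map_le_closure_of_le (hj : j + 1 ≤ P.m + P.K) (hE : ∀ n, Measurable fun W : Fin (n + 1) → G => ℰ.E W)
    {μ ν : Measure (GaugeField P j G)} (hμ : μ ≤ fieldMeasure P j G + ν) :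
    μ.map (avgFun ℰ) ≤
      fieldMeasure P (j + 1) G +
        (((fieldMeasure P j G).restrict {U : GaugeField P j G | ∃ c : PBond P (j + 1), Small ℰ U c}).map (avgFun ℰ) + ν.map (avgFun ℰ)) :=
  (Measure.map_mono hμ (measurable_avgFun ℰ hE)).trans (map_add_le_closure ℰ hj hE ν)

/-- **THE MASS OF THE GUARDED SUMMAND IS `dU(G)`**, hence `≤ #PBond(j+1)·Haar{dist1 < δ}` (part 6 `measure_guard_le`, `d ≥ 2`; part 7B sharpens the per-bond
factor to `Haar{dist1 < δ}^{L^{d−1}−1}`). [cite: Balaban1987RG1, (0.4) p.253 (bookkeeping)] -/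
theorem closure_mass (hj : j + 1 ≤ P.m + P.K) (hd : 2 ≤ P.d) (hE : ∀ n, Measurable fun W : Fin (n + 1) → G => ℰ.E W) :
    ((fieldMeasure P j G).restrict {U : GaugeField P j G | ∃ c : PBond P (j + 1), Small ℰ U c}).map (avgFun ℰ) Set.univ =
        fieldMeasure P j G {U : GaugeField P j G | ∃ c : PBond P (j + 1), Small ℰ U c} ∧
      fieldMeasure P j G {U : GaugeField P j G | ∃ c : PBond P (j + 1), Small ℰ U c} ≤
        Fintype.card (PBond P (j + 1)) * (HaarData.haar : Measure G) {g : G | dist1 g < ℰ.δ} := by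
  refine ⟨?_, measure_guard_le ℰ hj hd⟩
  rw [Measure.map_apply (measurable_avgFun ℰ hE) MeasurableSet.univ, Set.preimage_univ, Measure.restrict_apply_univ]

/-- The total mass of the next member of the family: `ν_{j+1}(univ) = dU(G) + ν(univ)`. [folklore] -/
theorem closure_mass_add (hE : ∀ n, Measurable fun W : Fin (n + 1) → G => ℰ.E W) (ν : Measure (GaugeField P j G)) :
    (((fieldMeasure P j G).restrict {U : GaugeField P j G | ∃ c : PBond P (j + 1), Small ℰ U c}).map (avgFun ℰ) + ν.map (avgFun ℰ)) Set.univ =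
      fieldMeasure P j G {U : GaugeField P j G | ∃ c : PBond P (j + 1), Small ℰ U c} + ν Set.univ := by
  rw [Measure.add_apply, Measure.map_apply (measurable_avgFun ℰ hE) MeasurableSet.univ, Measure.map_apply (measurable_avgFun ℰ hE) MeasurableSet.univ,
    Set.preimage_univ, Measure.restrict_apply_univ]

/-! ## §3 The same in the lane's transport currency `AveragingRT.pushDensity` -/

/-- ★ **THE TRANSPORT OF A BOUNDED DENSITY: `Ū_*(f·dU) ≤ C·dV + Ū_*((1_G·f)·dU)`** for every density `0 ≤ f ≤ C` (`AveragingRT.pushDensity Ū f =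
(f⁺·dU)∘Ū⁻¹`): the part of the transported mass that can exceed the flat bound `C·dV` is the transport of the density's restriction to the guard.  The
`rnDeriv` (∕ `rnTransport`) a.e. form follows by monotonicity of Radon–Nikodym derivatives under `AvgAC`. [cite: Balaban1987RG1, (0.13) p.254 (bookkeeping)] -/
theorem pushDensity_le (hj : j + 1 ≤ P.m + P.K) (hE : ∀ n, Measurable fun W : Fin (n + 1) → G => ℰ.E W)
    (f : GaugeField P j G → ℝ) {C : ℝ} (hf : ∀ U, f U ≤ C) :
    pushDensity (avgFun ℰ) f ≤
      ENNReal.ofReal C • fieldMeasure P (j + 1) G +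
        pushDensity (avgFun ℰ) ({U : GaugeField P j G | ∃ c : PBond P (j + 1), Small ℰ U c}.indicator f) := by
  have hind : (fun U => ENNReal.ofReal ({U : GaugeField P j G | ∃ c : PBond P (j + 1), Small ℰ U c}.indicator f U)) =
      {U : GaugeField P j G | ∃ c : PBond P (j + 1), Small ℰ U c}.indicator fun U => ENNReal.ofReal (f U) := by
    funext U
    by_cases hU : U ∈ {U : GaugeField P j G | ∃ c : PBond P (j + 1), Small ℰ U c}
    · rw [Set.indicator_of_mem hU, Set.indicator_of_mem hU]
    · rw [Set.indicator_of_notMem hU, Set.indicator_of_notMem hU, ENNReal.ofReal_zero]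
  unfold pushDensity
  rw [hind, withDensity_indicator (measurableSet_guard ℰ), ← restrict_withDensity (measurableSet_guard ℰ)]
  calc ((fieldMeasure P j G).withDensity fun U => ENNReal.ofReal (f U)).map (avgFun ℰ)
      ≤ ((fieldMeasure P j G).withDensity fun U => ENNReal.ofReal (f U)).map axialAvg +
          (((fieldMeasure P j G).withDensity fun U => ENNReal.ofReal (f U)).restrict
            {U : GaugeField P j G | ∃ c : PBond P (j + 1), Small ℰ U c}).map (avgFun ℰ) := map_avgFun_le ℰ hE _
    _ ≤ _ := by
        refine Measure.le_iff.2 fun s hs => ?_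
        simp only [Measure.add_apply]
        exact add_le_add (map_withDensity_axialAvg_le hj (fun U => ENNReal.ofReal_le_ofReal (hf U)) s) le_rfl

end Generic

/-! ## §4 At the [B10] slot's averaging `avOfPrint N S j` on `SU(N)` -/

section Slot

open Literature.MathematicalPhysics.QuantumFieldTheory.Balaban1985CMP102.Setting (Scales)
open Literature.MathematicalPhysics.QuantumFieldTheory.Balaban1983to89.B10RunsOfRecord (avOfPrint)
open Literature.MathematicalPhysics.QuantumFieldTheory.Balaban1983to89.ExpMeanLog (expMeanLogSU expMeanLogSU_δ measurable_expMeanLogSU_E)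
open Literature.MathematicalPhysics.QuantumFieldTheory.Balaban1983to89.Node00 (SU)

variable (N : ℕ) [NeZero N] {L : ℕ}

/-- **THE GUARD SPLIT AT THE SLOT**: `μ∘(avOfPrint)⁻¹ ≤ μ∘axial⁻¹ + (μ↾G)∘(avOfPrint)⁻¹` for EVERY measure `μ` on level-`j` fields over `SU(N)`, standing
range, every `N`. [cite: Balaban1987RG1, (0.4) p.253; Balaban1985UV3, (2) p.256 (bookkeeping)] -/
theorem map_avOfPrint_le (S : Scales L) {j : ℕ} (hj : j + 1 ≤ S.P.m + S.P.K) (μ : Measure (GaugeField S.P j (SU N))) :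
    μ.map (avOfPrint N S j).avg ≤ μ.map axialAvg +
      (μ.restrict {U : GaugeField S.P j (SU N) | ∃ c : PBond S.P (j + 1), Small (expMeanLogSU : LoopAverage (SU N)) U c}).map
        (avOfPrint N S j).avg := by
  rw [avOfPrint_avg_of_le N S hj]
  exact map_avgFun_le _ measurable_expMeanLogSU_E μ

/-- ★★ **THE CLOSURE STEP AT THE SLOT**: `(dU + ν)∘(avOfPrint)⁻¹ ≤ dV + [(dU↾G)∘(avOfPrint)⁻¹ + ν∘(avOfPrint)⁻¹]` for every measure `ν`, standing
range, every `N` — the CLAIM-18-closed family for PRINT'S OWN averaging. [cite: Balaban1987RG1, (0.4) p.253; Balaban1985UV3, (2) p.256 (bookkeeping)] -/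
theorem map_add_le_closure_avOfPrint (S : Scales L) {j : ℕ} (hj : j + 1 ≤ S.P.m + S.P.K) (ν : Measure (GaugeField S.P j (SU N))) :
    (fieldMeasure S.P j (SU N) + ν).map (avOfPrint N S j).avg ≤
      fieldMeasure S.P (j + 1) (SU N) +
        (((fieldMeasure S.P j (SU N)).restrict
            {U : GaugeField S.P j (SU N) | ∃ c : PBond S.P (j + 1), Small (expMeanLogSU : LoopAverage (SU N)) U c}).map (avOfPrint N S j).avg +
          ν.map (avOfPrint N S j).avg) := by
  rw [avOfPrint_avg_of_le N S hj]
  exact map_add_le_closure _ hj measurable_expMeanLogSU_E ν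

/-- **THE MASS OF THE SLOT'S GUARDED SUMMAND**: `= dU(G) ≤ #PBond(j+1)·Haar_{SU(N)}{‖W − 1‖ < min(1∕3, π∕N)}`, standing range, every `N`.
[cite: Balaban1987RG1, (0.4) p.253 (bookkeeping)] -/
theorem closure_mass_avOfPrint (S : Scales L) {j : ℕ} (hj : j + 1 ≤ S.P.m + S.P.K) :
    ((fieldMeasure S.P j (SU N)).restrict
          {U : GaugeField S.P j (SU N) | ∃ c : PBond S.P (j + 1), Small (expMeanLogSU : LoopAverage (SU N)) U c}).map
          (avOfPrint N S j).avg Set.univ =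
        fieldMeasure S.P j (SU N) {U : GaugeField S.P j (SU N) | ∃ c : PBond S.P (j + 1), Small (expMeanLogSU : LoopAverage (SU N)) U c} ∧
      fieldMeasure S.P j (SU N) {U : GaugeField S.P j (SU N) | ∃ c : PBond S.P (j + 1), Small (expMeanLogSU : LoopAverage (SU N)) U c} ≤
        Fintype.card (PBond S.P (j + 1)) * (HaarData.haar : Measure (SU N)) {g : SU N | dist1 g < min (1 / 3) (Real.pi / N)} := by
  have h := closure_mass (expMeanLogSU : LoopAverage (SU N)) hj (show 2 ≤ S.P.d by show 2 ≤ 3; norm_num) measurable_expMeanLogSU_E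
  rw [expMeanLogSU_δ, Fintype.card_fin] at h
  rw [avOfPrint_avg_of_le N S hj]
  exact h

/-- ★ **THE TRANSPORT OF A BOUNDED DENSITY AT THE SLOT**: `(avOfPrint)_*(f·dU) ≤ C·dV + (avOfPrint)_*((1_G·f)·dU)` for every density `0 ≤ f ≤ C`, standing
range, every `N` — in the lane's words: the [B7] (15) transport of a density bounded by `C` exceeds `C` (as a measure, against `dV`) by at most the transport
of the density's guarded part. [cite: Balaban1987RG1, (0.13) p.254; Balaban1985UV3, (2) p.256 (bookkeeping)] -/
theorem pushDensity_avOfPrint_le (S : Scales L) {j : ℕ} (hj : j + 1 ≤ S.P.m + S.P.K) (f : GaugeField S.P j (SU N) → ℝ) {C : ℝ}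
    (hf : ∀ U, f U ≤ C) :
    pushDensity (avOfPrint N S j).avg f ≤
      ENNReal.ofReal C • fieldMeasure S.P (j + 1) (SU N) +
        pushDensity (avOfPrint N S j).avg
          ({U : GaugeField S.P j (SU N) | ∃ c : PBond S.P (j + 1), Small (expMeanLogSU : LoopAverage (SU N)) U c}.indicator f) := by
  rw [avOfPrint_avg_of_le N S hj]
  exact pushDensity_le _ hj measurable_expMeanLogSU_E f hf

end Slot

end Summit.QuantumFields.YangMills.BalabanUVNodes.N08HaarCompatibilityGuardTransport
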